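import Summits.Ventures.PercRepro.RankLevelSetCorankFivePlanes

/-!
# PercRepro — the sharp counts of the small sets of rank `≤ 3` on the core of corank `5` (night-1, gen 2; sharp `d = 5`, part 2 of 3)

With the fan count of RankLevelSetCorankFivePlanes: the `5`-sets of rank `≤ 3` number at most
`A₅ ≤ 3·s₄ + 6·(ν(S₀) − 1)·s₃ ≤ 3·70 + 6·4·25 = 810` (they contain a `4`-circuit or a triangle), the `6`- and `7`-sets
of rank `3` at most `2·A₅` each (one-point extensions inside their plane), so the sets of rank `≤ 3` with `≥ 5` points
number at most `4050`, and `#{r ≤ 3} ≤ Σ_{j≤3} C(n,j) + (s₃·n + s₄) + 4050`.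

* `eRk_eq_of_mem_circuitsEq` — a circuit with `k + 1` elements has rank `k`;
* **`ncard_five_sets_eRk_le_three_core_sharp`** — `A₅ ≤ 810`;
* `ncard_eRk_le_three_ge_five_le_core` — `A₅ + A₆ + A₇ ≤ 4050`;
* **`ncard_eRk_le_three_le_core_sharp`** — the sharp count of the sets of rank `≤ 3`.
Axioms: standard.
-/

namespace PercRepro

namespace Matroid

open Set

variable {α : Type} {M : _root_.Matroid α}

/-- A circuit with `k + 1` elements has rank `k`. -/
theorem eRk_eq_of_mem_circuitsEq [M.Finite] {k : ℕ} {C : Set α} (hC : C ∈ circuitsEq M (k + 1)) :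
    M.eRk C = (k : ℕ∞) := by
  have hfin : C.Finite := M.ground_finite.subset hC.1.subset_ground
  have h := hC.1.eRk_add_one_eq
  rw [← hfin.cast_ncard_eq, hC.2] at h
  have hne : M.eRk C ≠ ⊤ := ne_top_of_le_ne_top hfin.encard_lt_top.ne (M.eRk_le_encard C)
  obtain ⟨m, hm⟩ := ENat.ne_top_iff_exists.1 hne
  rw [← hm] at h ⊢
  have hmk : m + 1 = k + 1 := by exact_mod_cast h
  exact_mod_cast (by omega : m = k)

/-- **`A₅ ≤ 810` on the core at corank `5`**: the `5`-sets of rank `≤ 3` either contain a `4`-circuit (`≤ 3·s₄`) or a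
triangle (`≤ 6·(ν(S₀) − 1)·s₃`), with `s₃ ≤ 25`, `s₄ ≤ 70`, `ν(S₀) ≤ 5`. -/
theorem ncard_five_sets_eRk_le_three_core_sharp [M.Finite]
    (hs : ∀ e ∈ M.E, ∀ f ∈ M.E, e ≠ f → M.eRk {e, f} = 2)
    (hfree : ∀ e ∈ M.E, ∃ A ⊆ M.E \ {e}, e ∉ M.closure A ∧ e ∉ M.closure ((M.E \ {e}) \ A))
    (hcirc : ∀ C, M.IsCircuit C → 3 ≤ C.encard) (hd : M.E.encard = M.eRank + 5) :
    {B : Set α | B ⊆ M.E ∧ B.ncard = 5 ∧ M.eRk B ≤ 3}.ncard ≤ 810 := by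
  classical
  obtain ⟨hSE, hS20, hν, hcov⟩ := sUnion_circuitsLE_five_props hd
  have hSfin : (⋃₀ circuitsLE M 4).Finite := M.ground_finite.subset hSE
  obtain ⟨d', hd'5, hd'⟩ := exists_nullity_of_le (d := 5) hSfin hν
  have hs3 := ncard_circuitsEq_three_le_corank_five_core hs hfree hd
  have hs4 := ncard_circuitsEq_four_le_corank_five hd
  -- the two parts
  set 𝓕₁ := {B : Set α | B ⊆ M.E ∧ B.ncard = 4 + 1 ∧ M.eRk B ≤ 3 ∧ ∃ A ∈ circuitsEq M 4, A ⊆ B}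
    with h𝓕₁
  have hfinℓ : ∀ ℓ : Set α,
      {B : Set α | B ⊆ ⋃₀ circuitsLE M 4 ∧ B.ncard = 5 ∧ M.eRk B = 3 ∧ ℓ ⊆ B}.Finite :=
    fun ℓ => hSfin.finite_subsets.subset (fun B hB => hB.1)
  let T₂ : Finset (Set α) := (circuitsEq_finite (M := M) 3).toFinset.biUnion (fun ℓ => (hfinℓ ℓ).toFinset)
  have hsub : {B : Set α | B ⊆ M.E ∧ B.ncard = 5 ∧ M.eRk B ≤ 3} ⊆ 𝓕₁ ∪ ↑T₂ := by
    rintro B ⟨hBE, hB5, hBr⟩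
    by_cases h : ∃ A ∈ circuitsEq M 4, A ⊆ B
    · exact Or.inl ⟨hBE, hB5, hBr, h⟩
    · push Not at h
      obtain ⟨ℓ, hℓ, hℓB⟩ := exists_triangle_subset_of_no_four_circuit hcirc hBE hB5 hBr h
      refine Or.inr ?_
      rw [Finset.mem_coe, Finset.mem_biUnion]
      refine ⟨ℓ, (circuitsEq_finite 3).mem_toFinset.2 hℓ, (hfinℓ ℓ).mem_toFinset.2 ?_⟩
      exact ⟨subset_sUnion_circuitsLE_of_eRk_le_three hs hfree hBE hBr (by omega), hB5,
        eRk_eq_three_of_four_le hs hfree hBE hBr (by omega), hℓB⟩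
  have h1 : 𝓕₁.ncard ≤ 3 * (circuitsEq M 4).ncard := by
    have := ncard_insert_le_of_eRk_three hs hfree (k := 4) (circuitsEq M 4) (circuitsEq_finite 4)
      (fun A hA => ⟨hA.1.subset_ground, eRk_eq_of_mem_circuitsEq (k := 3) hA, hA.2⟩)
    simpa using this
  have h2 : T₂.card ≤ (circuitsEq M 3).ncard * (6 * (d' - 1)) := by
    calc T₂.card ≤ ∑ ℓ ∈ (circuitsEq_finite (M := M) 3).toFinset, ((hfinℓ ℓ).toFinset).card :=
          Finset.card_biUnion_le
      _ ≤ ∑ ℓ ∈ (circuitsEq_finite (M := M) 3).toFinset, 6 * (d' - 1) := by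
          apply Finset.sum_le_sum
          intro ℓ hℓ
          rw [(circuitsEq_finite 3).mem_toFinset] at hℓ
          rw [← Set.ncard_eq_toFinset_card _ (hfinℓ ℓ)]
          exact ncard_fiveSets_through_triangle_le hs hfree hSE hd' (hcov ℓ hℓ.1 (by rw [hℓ.2]; norm_num))
            hℓ.2 (eRk_eq_of_mem_circuitsEq (k := 2) hℓ)
      _ = (circuitsEq M 3).ncard * (6 * (d' - 1)) := by
          rw [Finset.sum_const, smul_eq_mul, Set.ncard_eq_toFinset_card _ (circuitsEq_finite 3)]
  have hfin₁ : 𝓕₁.Finite := M.ground_finite.finite_subsets.subset (fun B hB => hB.1)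
  calc {B : Set α | B ⊆ M.E ∧ B.ncard = 5 ∧ M.eRk B ≤ 3}.ncard
      ≤ (𝓕₁ ∪ ↑T₂).ncard := Set.ncard_le_ncard hsub (hfin₁.union T₂.finite_toSet)
    _ ≤ 𝓕₁.ncard + (↑T₂ : Set (Set α)).ncard := Set.ncard_union_le _ _
    _ = 𝓕₁.ncard + T₂.card := by rw [Set.ncard_coe_finset]
    _ ≤ 3 * 70 + 25 * (6 * 4) := by
        have hd'1 : d' - 1 ≤ 4 := by omega
        have : (circuitsEq M 3).ncard * (6 * (d' - 1)) ≤ 25 * (6 * 4) :=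
          Nat.mul_le_mul hs3 (Nat.mul_le_mul_left 6 hd'1)
        omega
    _ = 810 := by norm_num

/-- **The sets of rank `≤ 3` with `≥ 5` points on the core at corank `5`: at most `5·810 = 4050`** — they have `5`, `6`
or `7` points ((C2)), and the `6`- and `7`-point ones are one-point extensions of smaller ones. -/
theorem ncard_eRk_le_three_ge_five_le_core [M.Finite]
    (hs : ∀ e ∈ M.E, ∀ f ∈ M.E, e ≠ f → M.eRk {e, f} = 2)
    (hfree : ∀ e ∈ M.E, ∃ A ⊆ M.E \ {e}, e ∉ M.closure A ∧ e ∉ M.closure ((M.E \ {e}) \ A))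
    (hcirc : ∀ C, M.IsCircuit C → 3 ≤ C.encard) (hd : M.E.encard = M.eRank + 5) :
    {X : Set α | X ⊆ M.E ∧ M.eRk X ≤ 3 ∧ 5 ≤ X.ncard}.ncard ≤ 4050 := by
  classical
  have hA5 := ncard_five_sets_eRk_le_three_core_sharp hs hfree hcirc hd
  -- the rank-exactly-3 families of sizes 5 and 6
  set 𝒜₅ := {B : Set α | B ⊆ M.E ∧ M.eRk B = 3 ∧ B.ncard = 5} with h𝒜₅
  set 𝒜₆ := {B : Set α | B ⊆ M.E ∧ M.eRk B = 3 ∧ B.ncard = 6} with h𝒜₆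
  have hfin₅ : 𝒜₅.Finite := M.ground_finite.finite_subsets.subset (fun B hB => hB.1)
  have hfin₆ : 𝒜₆.Finite := M.ground_finite.finite_subsets.subset (fun B hB => hB.1)
  have h5 : 𝒜₅.ncard ≤ 810 := by
    refine (Set.ncard_le_ncard ?_ ?_).trans hA5
    · rintro B ⟨hBE, hBr, hB5⟩
      exact ⟨hBE, hB5, hBr.le⟩
    · exact M.ground_finite.finite_subsets.subset (fun B hB => hB.1)
  -- every set of rank `≤ 3` with `k + 1 ≥ 5` points contains a rank-`3` `k`-subset (drop a point)
  have hdrop : ∀ (k : ℕ) (X : Set α), X ⊆ M.E → M.eRk X ≤ 3 → X.ncard = k + 1 → 4 ≤ k →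
      ∃ A, A ⊆ M.E ∧ M.eRk A = 3 ∧ A.ncard = k ∧ A ⊆ X := by
    intro k X hXE hXr hXk hk
    have hXfin : X.Finite := M.ground_finite.subset hXE
    obtain ⟨x, hx⟩ : X.Nonempty := by rw [← Set.ncard_pos hXfin]; omega
    refine ⟨X \ {x}, sdiff_subset.trans hXE, ?_, ?_, sdiff_subset⟩
    · exact eRk_eq_three_of_four_le hs hfree (sdiff_subset.trans hXE)
        ((M.eRk_mono sdiff_subset).trans hXr) (by rw [Set.ncard_sdiff_singleton_of_mem hx]; omega)
    · rw [Set.ncard_sdiff_singleton_of_mem hx]; omega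
  have h6 : 𝒜₆.ncard ≤ 2 * 810 := by
    have h := ncard_insert_le_of_eRk_three hs hfree (k := 5) 𝒜₅ hfin₅
      (fun A hA => ⟨hA.1, hA.2.1, hA.2.2⟩)
    have hsub : 𝒜₆ ⊆ {B : Set α | B ⊆ M.E ∧ B.ncard = 5 + 1 ∧ M.eRk B ≤ 3 ∧ ∃ A ∈ 𝒜₅, A ⊆ B} := by
      rintro B ⟨hBE, hBr, hB6⟩
      obtain ⟨A, hAE, hAr, hA5, hAB⟩ := hdrop 5 B hBE hBr.le hB6 (by norm_num)
      exact ⟨hBE, hB6, hBr.le, A, ⟨hAE, hAr, hA5⟩, hAB⟩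
    calc 𝒜₆.ncard ≤ _ := Set.ncard_le_ncard hsub
          (M.ground_finite.finite_subsets.subset (fun B hB => hB.1))
      _ ≤ (7 - 5) * 𝒜₅.ncard := h
      _ ≤ 2 * 810 := by omega
  have h7 : {B : Set α | B ⊆ M.E ∧ M.eRk B = 3 ∧ B.ncard = 7}.ncard ≤ 2 * 810 := by
    have h := ncard_insert_le_of_eRk_three hs hfree (k := 6) 𝒜₆ hfin₆
      (fun A hA => ⟨hA.1, hA.2.1, hA.2.2⟩)
    have hsub : {B : Set α | B ⊆ M.E ∧ M.eRk B = 3 ∧ B.ncard = 7} ⊆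
        {B : Set α | B ⊆ M.E ∧ B.ncard = 6 + 1 ∧ M.eRk B ≤ 3 ∧ ∃ A ∈ 𝒜₆, A ⊆ B} := by
      rintro B ⟨hBE, hBr, hB7⟩
      obtain ⟨A, hAE, hAr, hA6, hAB⟩ := hdrop 6 B hBE hBr.le hB7 (by norm_num)
      exact ⟨hBE, hB7, hBr.le, A, ⟨hAE, hAr, hA6⟩, hAB⟩
    calc {B : Set α | B ⊆ M.E ∧ M.eRk B = 3 ∧ B.ncard = 7}.ncard ≤ _ := Set.ncard_le_ncard hsub
          (M.ground_finite.finite_subsets.subset (fun B hB => hB.1))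
      _ ≤ (7 - 6) * 𝒜₆.ncard := h
      _ ≤ 2 * 810 := by omega
  -- every set of rank `≤ 3` with `≥ 5` points has rank `3` and `5`, `6` or `7` points
  have hsub : {X : Set α | X ⊆ M.E ∧ M.eRk X ≤ 3 ∧ 5 ≤ X.ncard} ⊆
      (𝒜₅ ∪ 𝒜₆) ∪ {B : Set α | B ⊆ M.E ∧ M.eRk B = 3 ∧ B.ncard = 7} := by
    rintro X ⟨hXE, hXr, hX5⟩
    have hr3 : M.eRk X = 3 := eRk_eq_three_of_four_le hs hfree hXE hXr (by omega)
    have hX7 : X.ncard ≤ 7 := ThmN.ncard_le_seven_of_eRk_three M hs hfree hXE hr3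
    rcases (show X.ncard = 5 ∨ X.ncard = 6 ∨ X.ncard = 7 by omega) with h | h | h
    · exact Or.inl (Or.inl ⟨hXE, hr3, h⟩)
    · exact Or.inl (Or.inr ⟨hXE, hr3, h⟩)
    · exact Or.inr ⟨hXE, hr3, h⟩
  have hfin₇ : {B : Set α | B ⊆ M.E ∧ M.eRk B = 3 ∧ B.ncard = 7}.Finite :=
    M.ground_finite.finite_subsets.subset (fun B hB => hB.1)
  calc {X : Set α | X ⊆ M.E ∧ M.eRk X ≤ 3 ∧ 5 ≤ X.ncard}.ncard
      ≤ ((𝒜₅ ∪ 𝒜₆) ∪ {B : Set α | B ⊆ M.E ∧ M.eRk B = 3 ∧ B.ncard = 7}).ncard :=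
        Set.ncard_le_ncard hsub ((hfin₅.union hfin₆).union hfin₇)
    _ ≤ (𝒜₅ ∪ 𝒜₆).ncard + {B : Set α | B ⊆ M.E ∧ M.eRk B = 3 ∧ B.ncard = 7}.ncard :=
        Set.ncard_union_le _ _
    _ ≤ (𝒜₅.ncard + 𝒜₆.ncard) + {B : Set α | B ⊆ M.E ∧ M.eRk B = 3 ∧ B.ncard = 7}.ncard := by
        gcongr
        exact Set.ncard_union_le _ _
    _ ≤ 4050 := by omega

/-- **The sets of rank `≤ 3` on the core at corank `5`, sharp**: at most `Σ_{j≤3} C(n,j) + (s₃·n + s₄) + 4050`. -/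
theorem ncard_eRk_le_three_le_core_sharp [M.Finite]
    (hs : ∀ e ∈ M.E, ∀ f ∈ M.E, e ≠ f → M.eRk {e, f} = 2)
    (hfree : ∀ e ∈ M.E, ∃ A ⊆ M.E \ {e}, e ∉ M.closure A ∧ e ∉ M.closure ((M.E \ {e}) \ A))
    (hcirc : ∀ C, M.IsCircuit C → 3 ≤ C.encard) (hd : M.E.encard = M.eRank + 5) :
    {X : Set α | X ⊆ M.E ∧ M.eRk X ≤ ((3 : ℕ) : ℕ∞)}.ncard ≤
      (∑ j ∈ Finset.range 4, M.E.ncard.choose j) +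
      ((circuitsEq M 3).ncard * M.E.ncard + (circuitsEq M 4).ncard) + 4050 := by
  classical
  have hsub : {X : Set α | X ⊆ M.E ∧ M.eRk X ≤ ((3 : ℕ) : ℕ∞)} ⊆
      ({X : Set α | X ⊆ M.E ∧ X.ncard ≤ 3} ∪ {B : Set α | B ⊆ M.E ∧ B.ncard = 4 ∧ M.eRk B ≤ 3}) ∪
        {X : Set α | X ⊆ M.E ∧ M.eRk X ≤ 3 ∧ 5 ≤ X.ncard} := by
    intro X hX
    obtain ⟨hXE, hXr⟩ := hX
    have hXr' : M.eRk X ≤ 3 := by exact_mod_cast hXr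
    rcases Nat.lt_or_ge X.ncard 4 with h | h
    · exact Or.inl (Or.inl ⟨hXE, by omega⟩)
    rcases Nat.lt_or_ge X.ncard 5 with h' | h'
    · exact Or.inl (Or.inr ⟨hXE, by omega, hXr'⟩)
    · exact Or.inr ⟨hXE, hXr', h'⟩
  have hfin1 : ({X : Set α | X ⊆ M.E ∧ X.ncard ≤ 3} ∪
      {B : Set α | B ⊆ M.E ∧ B.ncard = 4 ∧ M.eRk B ≤ 3}).Finite :=
    (M.ground_finite.finite_subsets.subset (fun X hX => hX.1)).union
      (M.ground_finite.finite_subsets.subset (fun X hX => hX.1))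
  have hfin2 : {X : Set α | X ⊆ M.E ∧ M.eRk X ≤ 3 ∧ 5 ≤ X.ncard}.Finite :=
    M.ground_finite.finite_subsets.subset (fun X hX => hX.1)
  have hE : M.ground_finite.toFinset.card = M.E.ncard :=
    (Set.ncard_eq_toFinset_card _ M.ground_finite).symm
  calc {X : Set α | X ⊆ M.E ∧ M.eRk X ≤ ((3 : ℕ) : ℕ∞)}.ncard
      ≤ (({X : Set α | X ⊆ M.E ∧ X.ncard ≤ 3} ∪ {B : Set α | B ⊆ M.E ∧ B.ncard = 4 ∧ M.eRk B ≤ 3}) ∪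
          {X : Set α | X ⊆ M.E ∧ M.eRk X ≤ 3 ∧ 5 ≤ X.ncard}).ncard :=
        Set.ncard_le_ncard hsub (hfin1.union hfin2)
    _ ≤ ({X : Set α | X ⊆ M.E ∧ X.ncard ≤ 3} ∪ {B : Set α | B ⊆ M.E ∧ B.ncard = 4 ∧ M.eRk B ≤ 3}).ncard +
          {X : Set α | X ⊆ M.E ∧ M.eRk X ≤ 3 ∧ 5 ≤ X.ncard}.ncard := Set.ncard_union_le _ _
    _ ≤ ({X : Set α | X ⊆ M.E ∧ X.ncard ≤ 3}.ncard +
          {B : Set α | B ⊆ M.E ∧ B.ncard = 4 ∧ M.eRk B ≤ 3}.ncard) +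
          {X : Set α | X ⊆ M.E ∧ M.eRk X ≤ 3 ∧ 5 ≤ X.ncard}.ncard := by
        gcongr
        exact Set.ncard_union_le _ _
    _ ≤ (∑ j ∈ Finset.range 4, M.E.ncard.choose j) +
          ((circuitsEq M 3).ncard * M.E.ncard + (circuitsEq M 4).ncard) + 4050 := by
        have h1 := ncard_subsets_ncard_le_le (M := M) 3
        rw [show (3 + 1 : ℕ) = 4 from rfl] at h1
        have h2 := ncard_four_sets_eRk_le_three (M := M) hcirc
        rw [hE] at h2
        have h3 := ncard_eRk_le_three_ge_five_le_core hs hfree hcirc hd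
        omega

end Matroid


end PercRepro
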